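import Summits.BirchSwinnertonDyer.BirchSwinnertonDyer.Theorems.PrintX8VerticalStevensBridgeBy
import Literature.NumberTheory.EllipticCurves.CuspFormLFunctionLevelConductorProofs
import Literature.NumberTheory.EllipticCurves.Rank1Residual.Predicates
import HarnessLib

/-!
# Route `PrintX8`, crux 20714 `SharpFlatMuAnSmallImageX8` — LINE «layered Stevens at 3»: LS-B PROVED
# (curve forms of the generic bridge: `BridgeBy`, two layers ⟹ `CycWindingUnitTwoLayersAt`)

Cell `bsd-print-x8`, seat p1 (gen 4), `--supports stmt-BirchSwinnertonDyer-20622` (serves 20714's line LS as well).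
Theorems only; route-independent.  `bridgeBy` = the planner's `LS.BridgeBy W p` (unfolded, `W` elliptic);
`cycWindingUnitTwoLayersAt_of_layerEisSpanTwoModGen` = `LS.BridgeLS W p` with the two hypotheses the method needs
made explicit (`p` odd, good reduction at `p`); `cycWindingUnitTwoLayersAt_three_of_goodSS` (every `3`-supersingular
curve) and `cycWindingUnitTwoLayersAt_of_layeredStevensModAtThree` (LS-0(3) ⟹ the two-layer carrier on all of X8 —
the input of seat p3's collapse LS-G `LS.CollapseLS`).
-/

-- the summit namespace repeats `BirchSwinnertonDyer` by design (summit = problem); linter moot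
set_option linter.dupNamespace false
set_option autoImplicit false

noncomputable section

namespace Summit.BirchSwinnertonDyer.BirchSwinnertonDyer.Theorems.PrintX8VerticalStevens

open scoped MatrixGroups ModularForm

open CongruenceSubgroup Matrix Matrix.SpecialLinearGroup
  Literature.NumberTheory.EllipticCurves Literature.NumberTheory.EllipticCurves.ModularForms
  Literature.NumberTheory.EllipticCurves.Rank1Residual

section Curves

variable (W : WeierstrassCurve ℚ) [W.IsElliptic] [W.IsGloballyMinimal] (p : ℕ) [Fact p.Prime]

/-- **`BridgeBy W p` PROVED** (the planner's predicate `plan/ls/SketchLS.lean` `LS.BridgeBy`, unfolded, for an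
elliptic `W`): for every newform `f` of `E` at a level `N` with `p ∤ 2N`, if `a_p(E) ≢ 1 (mod p)` then every test
set `S` with `SpanModBy N p S` contains an element with a unit symbol difference `[γ·0]⁺_f − [0]⁺_f`. -/
theorem bridgeBy {N : ℕ} [NeZero N] (f : CuspForm (Gamma0 N) 2) (hf : IsNewformOf W f) (h2N : ¬ p ∣ 2 * N)
    (hap1 : ¬ ((p : ℤ) ∣ W.frobeniusTrace p - 1)) (S : Set (Gamma0 N)) (hS : SpanModBy N p S) :
    ∃ γ ∈ S, 1 ≤ ‖((ratPlusSymbol f ((((γ : SL(2, ℤ)) 0 1 : ℤ) : ℚ) / (((γ : SL(2, ℤ)) 1 1 : ℤ) : ℚ)) -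
        ratPlusSymbol f 0 : ℚ) : ℚ_[p])‖ := by
  have hp : p.Prime := Fact.out
  have hp2 : p ≠ 2 := by rintro rfl; exact h2N (dvd_mul_right 2 N)
  have hpN : ¬ p ∣ N := fun h ↦ h2N (dvd_mul_of_dvd_right h 2)
  have hgood : W.HasGoodReductionAtPrime p := by
    by_contra hbad
    exact hpN ((hf.dvd_level_iff_dvd_conductorNorm hp).mpr
      ((W.dvd_conductorNorm_iff_not_hasGoodReductionAtPrime p).mpr hbad))
  exact exists_mem_one_le_norm_sub_of_spanModBy hf.1 hf.coeffField_eq_bot hp2 hpN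
    (cuspCoeff_eq_frobeniusTrace_of_isNewformOf_holds hf hgood) hap1 S hS

/-- **LS-B PROVED** (the planner's `LS.BridgeLS W p` with the two hypotheses the method needs made explicit:
`p` odd and of good reduction): two certified consecutive layers at the level of every newform of `E`, and
`a_p(E) ≢ 1 (mod p)`, give the two-layer carrier `CycWindingUnitTwoLayersAt W p` (ty2 p561961). -/
theorem cycWindingUnitTwoLayersAt_of_layerEisSpanTwoModGen (hp2 : p ≠ 2) (hgood : W.HasGoodReductionAtPrime p)
    (hap1 : ¬ ((p : ℤ) ∣ W.frobeniusTrace p - 1))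
    (hL : ∀ {N : ℕ} [NeZero N] (f : CuspForm (Gamma0 N) 2), IsNewformOf W f → LayerEisSpanTwoModGen N p) :
    CycWindingUnitTwoLayersAt W p := by
  intro N _ f hf
  have hp : p.Prime := Fact.out
  have hpN : ¬ p ∣ N := fun h ↦
    (W.dvd_conductorNorm_iff_not_hasGoodReductionAtPrime p).mp
      ((hf.dvd_level_iff_dvd_conductorNorm hp).mp h) hgood
  have hap := cuspCoeff_eq_frobeniusTrace_of_isNewformOf_holds hf hgood
  obtain ⟨k, hk, hLk, hLk1⟩ := hL f hf
  obtain ⟨b, hb, hbu⟩ := exists_one_le_norm_layer_of_layerEisSpanModGen hf.1 hf.coeffField_eq_bot hp2 hpN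
    hap hap1 hk hLk
  obtain ⟨b', hb', hb'u⟩ := exists_one_le_norm_layer_of_layerEisSpanModGen hf.1 hf.coeffField_eq_bot hp2
    hpN hap hap1 (by omega : 1 ≤ k + 1) hLk1
  exact ⟨k, b, b', hk, hb, hb', hbu, hb'u⟩

omit [Fact p.Prime] in
/-- **LS-B on the `3`-supersingular class** (X8 and the `p = 3` part of X6/X7: `GoodSS W 3`, so `3 ∤ a₃ − 1`
automatically): two certified consecutive layers at the level of every newform ⟹ `CycWindingUnitTwoLayersAt W 3`
— the input of the planner's collapse `LS.CollapseLS` (seat p3, LS-G). -/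
theorem cycWindingUnitTwoLayersAt_three_of_goodSS (hss : GoodSS W 3)
    (hL : ∀ {N : ℕ} [NeZero N] (f : CuspForm (Gamma0 N) 2), IsNewformOf W f → LayerEisSpanTwoModGen N 3) :
    CycWindingUnitTwoLayersAt W 3 := by
  refine cycWindingUnitTwoLayersAt_of_layerEisSpanTwoModGen W 3 (by norm_num) hss.1 ?_ hL
  rintro ⟨k, hk⟩
  obtain ⟨l, hl⟩ := hss.2
  omega

omit [Fact p.Prime] in
/-- **LS-0(3) ⟹ the two-layer carrier on X8** (class-wide, image-free): the planner's
`LS.LayeredStevensModAt 3` (every level prime to `3` eventually satisfies LAYER-EIS-SPAN mod `3`) gives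
`CycWindingUnitTwoLayersAt W p` on every X8 pair (indeed on every `3`-supersingular curve). -/
theorem cycWindingUnitTwoLayersAt_of_layeredStevensModAtThree
    (hLS : ∀ M : ℕ, 0 < M → ¬ 3 ∣ M → ∃ m₀ : ℕ, ∀ m : ℕ, m₀ ≤ m → LayerEisSpanModGen M 3 m) :
    ∀ (W : WeierstrassCurve ℚ) [W.IsElliptic] [W.IsGloballyMinimal] (p : ℕ) [Fact p.Prime],
      ClassX8 W p → CycWindingUnitTwoLayersAt W p := by
  intro W _ _ p _ hX8
  obtain ⟨rfl, hss, -⟩ := hX8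
  refine cycWindingUnitTwoLayersAt_three_of_goodSS W hss fun {M} _ f hf ↦ ?_
  have h3M : ¬ 3 ∣ M := fun h ↦
    (W.dvd_conductorNorm_iff_not_hasGoodReductionAtPrime 3).mp
      ((hf.dvd_level_iff_dvd_conductorNorm Nat.prime_three).mp h) hss.1
  obtain ⟨m₀, hm₀⟩ := hLS M (NeZero.pos M) h3M
  exact ⟨m₀ + 1, by omega, hm₀ _ (by omega), hm₀ _ (by omega)⟩

end Curves

end Summit.BirchSwinnertonDyer.BirchSwinnertonDyer.Theorems.PrintX8VerticalStevens

end
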